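import Literature.NumberTheory.Automorphic.ShimuraCurveRibetTakahashi
import HarnessLib

/-!
# Pasten's refined Ribet–Takahashi formula, Theorem 6.1 (a): the denominator of `γ_{D,M,E}` for
# curves semi-stable away from `S` is at most `κ_S^{ω(D)} · D`

Topic `Literature/NumberTheory/Automorphic` (family `abc`; candidate column A1′ of LADDER-ABC;
cross-ladder literature-typing seat lit-abc-pasten g6). ONE named fact (`def … : Prop`, CONVENTIONS
§4, typed ≠ proved), the item (a) that `ShimuraCurveRibetTakahashi.lean` lists under "Not here:
Thm 6.1 (a) (general `S`)", stated in exactly the idiom of its siblings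
`PastenShimura2024_thm_6_1` (numerator) and `PastenShimura2024_thm_6_1_b` (denominator, classes
(b.1)/(b.2)), from

* H. Pasten, *Shimura curves and the abc conjecture*, J. Number Theory **254** (2024) 214–335 =
  arXiv:1705.09251v4 [`PastenShimura2024`] (held TeX, READ: §6.2 display (6.1) and Thm. 6.1 p. 20,
  §6.6 Lemma 6.14 p. 23, §6.7 Lemma 6.15 p. 24, Lemma 6.18 and §6.9 p. 25):

  > **Theorem 6.1.** Let `E` be an elliptic curve over `ℚ` of conductor `N` and let `N = DM` be an
  > admissible factorization. […] Furthermore, the following upper bounds for the denominator of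
  > `γ_{D,M,E}` hold: **(a)** Let `S` be a finite set of primes. There is a positive integer `κ_S`
  > depending only on `S` and supported on primes `≤ 163` such that if `E` is semi-stable away from
  > `S`, then the denominator of `γ_{D,M,E}` is less than or equal to `κ_S^{ω(D)} D`. In particular,
  > `log(∏_{p∣D} v_p(Δ_E)) ≤ log δ_{1,N} − log δ_{D,M} + log D + O_S(ω(D))` where the implicit
  > constant only depends on `S`.

  with `δ_{1,N}/δ_{D,M} = γ_{D,M,E} · ∏_{p∣D} v_p(Δ_E)` (display (6.1)), `Δ_E` the minimal
  discriminant, `ω(D) = #D.primeFactors`, and "semi-stable away from `S`" = "if `p² ∣ N` for a prime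
  `p`, then `p ∈ S`" (Thm. 1.3 p. 4). This is the input (EqUsingRT) of the proof of **Theorem 16.1**
  (p. 49: "From Theorem 6.1, Item (a), we have `log(∏_{p∣D} v_p(Δ_E)) ≤ log δ_{1,N} − log δ_{D,M} +
  log D + O_S(log D / log log D)`").

## Rendering (the reviewer's checklist; identical to `PastenShimura2024_thm_6_1_b`)

* `E` = a globally minimal `W` of conductor `N` (`[W.IsGloballyMinimal]`, `W.conductorNorm ℤ = N`,
  `[NeZero N]`), `N = DM` admissible (`IsAdmissibleFactorization N D M`), `X : ShimuraCurveData D M`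
  any presentation; `δ_{1,N} = D₁.modularDegree` for a classical datum `D₁` carrying the newform of
  `W` (`IsNewformOf W D₁.f`) of minimal degree among all data at level `N` with that newform;
  `δ_{D,M} = P.deg` for `P.IsMinimalFor W`; `v_p(Δ_E) = (W.minimalDiscriminantNorm ℤ).factorization p`.
* "semi-stable away from `S`" = `∀ p prime, p ∉ S → ¬ p² ∣ N` (the idiom of `PastenShimura2024_cor_10_2`
  and `PastenShimura2024_pairwise_denominator`).
* "`κ_S` a positive integer depending only on `S`, supported on primes `≤ 163`" =
  `∀ S, ∃ κ, 1 ≤ κ ∧ ∀ p ∈ κ.primeFactors, p ≤ 163`, chosen BEFORE the curve.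
* "the denominator of `γ_{D,M,E}` is `≤ κ_S^{ω(D)} D`" = `∃ a b ≥ 1` with `b ≤ κ^{ω(D)} · D` and
  `δ_{1,N} · b = a · δ_{D,M} · ∏_{p∣D} v_p(Δ_E)` — EQUIVALENT to the printed statement (the reduced
  denominator of `a/b` divides `b`), exactly as (b)'s "divides `κ^{ω(D)}`" is rendered `b ∣ κ^{ω(D)}`.
  No hypothesis on `E` beyond semi-stability away from `S`; `D = 1` allowed (then `γ_{1,N,E} = 1`).

## Status

PROVED IN PRINT (§6.9 p. 25: (EqSequentially) from Prop. 6.13 = Ribet–Takahashi 1997 Thm. 2 and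
Lemma 6.8 (Mazur–Kenku), applied along `D = p₁r₁⋯pₙrₙ` with `rᵢ < pᵢ`; the Eisenstein factors
`i_p(d, prm)²` bounded by Lemma 6.14 — "`i_p(J₀^D(M), χ_{D,M})` divides an integer `κ_S` which only
depends on `S`" — and the cokernel factors `j_r(dpr, m)²` by Lemma 6.18 — "`j_p(D,M)` divides `p − 1`
if `p` is odd, and it divides `2` if `p = 2`", Papikian–Rabinoff Cor. 3.5 — whose total contribution
is `r₁²⋯rₙ² < D`). None of the geometric inputs (Néron models and component groups `Φ_p` of
`J₀^D(M)` and of `q_{D,M}`, the orders `i_p`, `j_p` of §6.6) has a carrier in Mathlib or the tree,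
as recorded for (b) in `ShimuraCurveRibetTakahashi.lean`; the tree's reductions of (b)
(`PastenShimura2024_thm_6_1_b_of_prop_6_13_bounded_of_mazurKenku`, Cokernel/Denominator proof
files) have no (a)-twin yet. Typed, not proved. Consumer: `pastenShimura2024_thm_16_1_of_engine`
(`DiophantineGeometry/PastenThm161FromShimuraEngineProofs.lean`), which makes the tree's
`pastenShimura2024_thm_16_1` (hence Cor. 16.2, Thm. 1.15, Thm. 1.12) a theorem over the engine.

## What is NOT here

Item (b) and the numerator statement (siblings in `ShimuraCurveRibetTakahashi.lean`); the proof;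
the "In particular" logarithmic form (a consequence: `log b ≤ ω(D) log κ_S + log D`).

## References

* [PastenShimura2024] H. Pasten, J. Number Theory 254 (2024) = arXiv:1705.09251v4: Thm. 6.1 (a)
  p. 20, display (6.1), Lemma 6.14 p. 23, Lemma 6.18 and §6.9 p. 25, §16.1 p. 49 ((EqUsingRT)).
* [RibetTakahashi1997] K. Ribet, S. Takahashi, PNAS 94 (1997) 11110–11114 (Prop. 6.13).
-/

noncomputable section

open scoped MatrixGroups

namespace Literature.NumberTheory.Automorphic

open Literature.NumberTheory.EllipticCurves.ModularForms (ModularParametrizationData IsNewformOf)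

/-- NAMED FACT — **Pasten 2024, Theorem 6.1 (a) — the denominator of `γ_{D,M,E}` for curves
semi-stable away from `S`.** Printed (arXiv:1705.09251v4 p. 20): "(a) Let `S` be a finite set of
primes. There is a positive integer `κ_S` depending only on `S` and supported on primes `≤ 163` such
that if `E` is semi-stable away from `S`, then the denominator of `γ_{D,M,E}` is less than or equal
to `κ_S^{ω(D)} D`. In particular, `log(∏_{p∣D} v_p(Δ_E)) ≤ log δ_{1,N} − log δ_{D,M} + log D + O_S(ω(D))`
where the implicit constant only depends on `S`" (for `E/ℚ` of conductor `N`, `N = DM` admissible,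
`δ_{1,N}/δ_{D,M} = γ_{D,M,E} · ∏_{p∣D} v_p(Δ_E)`, display (6.1)). Rendering exactly as
`PastenShimura2024_thm_6_1_b` (module docstring): `E` = a globally minimal `W` of conductor `N`,
"semi-stable away from `S`" = `p² ∤ N` for primes `p ∉ S`, `δ_{1,N} = D₁.modularDegree`
(class-minimal classical datum with the newform of `W`), `δ_{D,M} = P.deg` (`P.IsMinimalFor W`);
conclusion `δ_{1,N} · b = a · δ_{D,M} · ∏_{p∣D} v_p(Δ_E)` for some `a, b ≥ 1` with
`b ≤ κ_S^{ω(D)} · D` (equivalent to the printed bound on the reduced denominator). PROVED IN PRINT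
(§6.9 p. 25: (EqSequentially) = Prop. 6.13 [Ribet–Takahashi] + Lemma 6.8 [Mazur–Kenku], Lemma 6.14
for the Eisenstein factors `i_p ∣ κ_S`, Lemma 6.18 [Papikian–Rabinoff] for the cokernel factors
`j_r ∣ r − 1`, ordering `rᵢ < pᵢ` so that `∏ rᵢ² < D`); the component groups `Φ_p` of `J₀^D(M)` have
no carrier in the tree — typed, not proved. [cite: PastenShimura2024, Thm. 6.1 (a) p. 20 (arXiv:1705.09251v4), with §6.9 p. 25] -/
def PastenShimura2024_thm_6_1_a : Prop :=
  ∀ S : Finset ℕ, ∃ κ : ℕ, 1 ≤ κ ∧ (∀ p ∈ κ.primeFactors, p ≤ 163) ∧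
  ∀ {N D M : ℕ} [NeZero N], IsAdmissibleFactorization N D M →
    ∀ (X : ShimuraCurveData D M) (W : WeierstrassCurve ℚ) [W.IsElliptic] [W.IsGloballyMinimal],
      W.conductorNorm ℤ = N → (∀ p : ℕ, p.Prime → p ∉ S → ¬ p ^ 2 ∣ N) →
    ∀ (W₁ : WeierstrassCurve ℚ) [W₁.IsElliptic] (D₁ : ModularParametrizationData W₁ N),
      IsNewformOf W D₁.f →
      (∀ (W₂ : WeierstrassCurve ℚ) [W₂.IsElliptic] (D₂ : ModularParametrizationData W₂ N),
          D₂.f = D₁.f → D₁.modularDegree ≤ D₂.modularDegree) →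
    ∀ (W' : WeierstrassCurve ℚ) [W'.IsElliptic] (P : ShimuraParametrizationData X W'),
      P.IsMinimalFor W →
        ∃ a b : ℕ, 0 < a ∧ 0 < b ∧ b ≤ κ ^ D.primeFactors.card * D ∧
          D₁.modularDegree * b =
            a * P.deg * ∏ p ∈ D.primeFactors, (W.minimalDiscriminantNorm ℤ).factorization p

namespace PastenShimura2024_thm_6_1_a

/-- **The printed "In particular" of Thm. 6.1 (a)** in multiplicative form: under (a),
`δ_{D,M} · ∏_{p∣D} v_p(Δ_E) ≤ κ_S^{ω(D)} · D · δ_{1,N}` (from `δ_{1,N} b = a δ_{D,M} ∏ v_p`, `a ≥ 1`,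
`b ≤ κ_S^{ω(D)} D`) — i.e. `log ∏ v_p ≤ log δ_{1,N} − log δ_{D,M} + log D + ω(D) log κ_S`.
[cite: PastenShimura2024, Thm. 6.1 (a) p. 20 ("In particular")] -/
theorem deg_mul_prod_le (h : PastenShimura2024_thm_6_1_a) (S : Finset ℕ) :
    ∃ κ : ℕ, 1 ≤ κ ∧ ∀ {N D M : ℕ} [NeZero N], IsAdmissibleFactorization N D M →
      ∀ (X : ShimuraCurveData D M) (W : WeierstrassCurve ℚ) [W.IsElliptic] [W.IsGloballyMinimal],
        W.conductorNorm ℤ = N → (∀ p : ℕ, p.Prime → p ∉ S → ¬ p ^ 2 ∣ N) →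
      ∀ (W₁ : WeierstrassCurve ℚ) [W₁.IsElliptic] (D₁ : ModularParametrizationData W₁ N),
        IsNewformOf W D₁.f →
        (∀ (W₂ : WeierstrassCurve ℚ) [W₂.IsElliptic] (D₂ : ModularParametrizationData W₂ N),
            D₂.f = D₁.f → D₁.modularDegree ≤ D₂.modularDegree) →
      ∀ (W' : WeierstrassCurve ℚ) [W'.IsElliptic] (P : ShimuraParametrizationData X W'),
        P.IsMinimalFor W →
          P.deg * ∏ p ∈ D.primeFactors, (W.minimalDiscriminantNorm ℤ).factorization p ≤
            κ ^ D.primeFactors.card * D * D₁.modularDegree := by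
  obtain ⟨κ, hκ1, -, hκ⟩ := h S
  refine ⟨κ, hκ1, ?_⟩
  intro N D M _ hadm X W _ _ hWN hS W₁ _ D₁ hnew hmin W' _ P hP
  obtain ⟨a, b, ha, hb, hbκ, hEq⟩ := hκ hadm X W hWN hS W₁ D₁ hnew hmin W' P hP
  set T := ∏ p ∈ D.primeFactors, (W.minimalDiscriminantNorm ℤ).factorization p
  calc P.deg * T ≤ a * P.deg * T := by
        rw [mul_assoc]; exact Nat.le_mul_of_pos_left _ ha
    _ = D₁.modularDegree * b := hEq.symm
    _ ≤ D₁.modularDegree * (κ ^ D.primeFactors.card * D) := Nat.mul_le_mul_left _ hbκ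
    _ = κ ^ D.primeFactors.card * D * D₁.modularDegree := by ring

end PastenShimura2024_thm_6_1_a

end Literature.NumberTheory.Automorphic

end
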